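import Literature.RepresentationTheory.FiniteGroups.StableLatticeReductionHom
import HarnessLib

/-!
# "The Herbrand quotient of a finite module is `1`" for invariants additive on `p`-torsion modules:
# `ψ(X/pX) = ψ(X[p])` for EVERY finite `ℤ[G]`-module `X`

Topic `RepresentationTheory/FiniteGroups`; namespace `Literature.RepresentationTheory.FiniteGroups`,
sub-namespace `StableLatticeReduction.Int` (continuation of `StableLatticeReductionInvariantInt` /
`StableLatticeReductionHom`).  THEOREMS ONLY (no definition, no named fact, no `sorry`, no instance).

For a finite `ℤ[G]`-module `X` (any monoid `G`, any action) and a prime `p`, the `𝔽_p[G]`-modules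
`X/pX` and `X[p]` have the same class in the Grothendieck group of finite `𝔽_p[G]`-modules; here:
**`additive_reduction_eq_torsionBy_of_finite`** — `ψ(X/pX) = ψ(X[p])` for every function `ψ` on
`ℤ`-linear `G`-representations that is additive on short exact sequences with FINITE `p`-TORSION
middle term (the binder pair of `StableLatticeReductionInvariantInt`).  The tree's
`StableLatticeReduction.additive_torsionBy_eq_quotient` proves this for `ψ` additive on ALL finite
modules (two short exact sequences through `X` itself); `additive_reduction_eq_torsionBy_of_isAddCyclic`
(`StableLatticeReductionHom`) for cyclic `X`.  The general case is a strong induction on `#X` through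
`pX`: multiplication by `p` induces `X/pX ↠ pX/p²X` with kernel `X[p]/(pX)[p]`, all four terms being
`𝔽_p[G]`-modules, so `ψ(X/pX) − ψ(X[p]) = ψ(pX/p·pX) − ψ((pX)[p])`, which vanishes by induction
(`#pX < #X` unless `X[p] = 0`, when both sides are `0`).

Lane «TATE-EPC-TC» of cell `bsd-eis` (brick B8, step (γ) of the `Δ`-equivariant Kummer bookkeeping:
`[𝓗¹(E_S)[p]] = [𝓗¹(E_S)/p]` for the finite module `𝓗¹`; Milne, *ADT* I §5, proof of Thm. 5.1).

## References
* [MilneADT2006] J. S. Milne, *Arithmetic Duality Theorems*, I Lemma 2.12, Lemma 5.3 (proof: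
  "the Herbrand quotient of a finite module is 1").
* [CasselsFrohlichANT1967] Cassels–Fröhlich, *Algebraic Number Theory*, Ch. IV §8 Prop. 11.
* [SerreLinearRepresentations1977] J.-P. Serre, *Linear Representations of Finite Groups*, §15.2.
-/

universe u

namespace Literature.RepresentationTheory.FiniteGroups

namespace StableLatticeReduction.Int

open Function LinearMap Submodule StableLatticeReduction
open scoped Pointwise

variable {G : Type*} [Monoid G] {A : Type*} [AddCommGroup A] {p : ℕ}

variable (ψ : ∀ ⦃X : Type u⦄ [AddCommGroup X] [Module ℤ X], Representation ℤ G X → A)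
  (hψ : ∀ ⦃X Y Z : Type u⦄ [AddCommGroup X] [Module ℤ X] [AddCommGroup Y] [Module ℤ Y]
    [AddCommGroup Z] [Module ℤ Z] (ρX : Representation ℤ G X) (ρY : Representation ℤ G Y)
    (ρZ : Representation ℤ G Z) (f : X →ₗ[ℤ] Y) (g : Y →ₗ[ℤ] Z),
    (∀ s x, f (ρX s x) = ρY s (f x)) → (∀ s y, g (ρY s y) = ρZ s (g y)) →
    Injective f → Surjective g → LinearMap.range f = LinearMap.ker g → Finite Y →
    (∀ y : Y, (p : ℤ) • y = 0) → ψ ρY = ψ ρX + ψ ρZ)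
include hψ

/-- `ψ` vanishes on a trivial module (from `hψ` alone). [cite: SerreLinearRepresentations1977, §15.2] -/
theorem additive_eq_zero_of_subsingleton' {X : Type u} [AddCommGroup X] [Module ℤ X] [Subsingleton X]
    (ρX : Representation ℤ G X) : ψ ρX = 0 := by
  haveI : Finite X := Finite.of_subsingleton
  have h := hψ ρX ρX ρX LinearMap.id LinearMap.id (fun _ _ => rfl) (fun _ _ => rfl)
    injective_id surjective_id (by rw [LinearMap.range_id, LinearMap.ker_id]; exact Subsingleton.elim _ _)
    ‹_› (fun y => Subsingleton.elim _ _)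
  have h2 : ψ ρX + ψ ρX = ψ ρX + 0 := by rw [add_zero]; exact h.symm
  exact add_left_cancel h2

/-- **`ψ(X/pX) = ψ(X[p])` for every FINITE `ℤ[G]`-module `X`** and every invariant `ψ` additive on
finite `p`-torsion modules ("the Herbrand quotient of a finite module is `1`", in the Grothendieck
group of `𝔽_p[G]`-modules).  Strong induction on `#X` through `pX`.
[cite: MilneADT2006, I Lemma 2.12 and Lemma 5.3 (proof)] [cite: CasselsFrohlichANT1967, Ch. IV §8 Prop. 11] -/
theorem additive_reduction_eq_torsionBy_of_finite [Fact p.Prime] {X : Type u} [AddCommGroup X]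
    [Finite X] (ρX : Representation ℤ G X) :
    ψ (ρX.quotient ((p : ℤ) • ⊤) (smul_top_le_comap ρX (p : ℤ))) =
      ψ (ρX.subrepresentation (torsionBy ℤ X (p : ℤ)) (torsionBy_le_comap ρX (p : ℤ))) := by
  -- strong induction on the cardinality
  suffices h : ∀ (n : ℕ) {Y : Type u} [AddCommGroup Y] [Finite Y] (ρY : Representation ℤ G Y),
      Nat.card Y = n →
      ψ (ρY.quotient ((p : ℤ) • ⊤) (smul_top_le_comap ρY (p : ℤ))) =
        ψ (ρY.subrepresentation (torsionBy ℤ Y (p : ℤ)) (torsionBy_le_comap ρY (p : ℤ))) from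
    h _ ρX rfl
  intro n
  induction n using Nat.strong_induction_on with
  | _ n ih =>
  intro Y _ _ ρY hn
  classical
  obtain ⟨good_sub, good_quot, hψ'⟩ := admissible ψ hψ
  -- notation
  set T : Submodule ℤ Y := torsionBy ℤ Y (p : ℤ) with hTdef
  set P : Submodule ℤ Y := (p : ℤ) • ⊤ with hPdef
  have hT : ∀ s, T ≤ T.comap (ρY s) := torsionBy_le_comap ρY (p : ℤ)
  have hP : ∀ s, P ≤ P.comap (ρY s) := smul_top_le_comap ρY (p : ℤ)
  set ρT := ρY.subrepresentation T hT with hρT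
  set ρP := ρY.subrepresentation P hP with hρP
  set ρQ := ρY.quotient P hP with hρQ
  -- goodness facts
  have hQtors : ∀ q : Y ⧸ P, (p : ℤ) • q = 0 := smul_quotient_smul_top_eq_zero (p : ℤ)
  have hTtors : ∀ t : T, (p : ℤ) • t = 0 := fun t =>
    Subtype.ext (by rw [Submodule.coe_smul, Submodule.coe_zero]; exact (mem_torsionBy_iff _ _).1 t.2)
  haveI : Finite (Y ⧸ P) := Finite.of_surjective _ (mkQ_surjective P)
  by_cases hbot : T = ⊥
  · -- no `p`-torsion: both sides vanish
    have hinj : ∀ x : Y, (p : ℤ) • x = 0 → x = 0 := fun x hx => by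
      have : x ∈ T := (mem_torsionBy_iff _ _).2 hx
      rw [hbot] at this
      exact (Submodule.mem_bot ℤ).1 this
    haveI : Subsingleton T := by rw [hbot]; infer_instance
    have hsurj : Function.Surjective fun x : Y => (p : ℤ) • x :=
      Finite.surjective_of_injective fun a b hab => sub_eq_zero.1 (hinj _ (by
        rw [smul_sub]; exact sub_eq_zero.2 hab))
    haveI : Subsingleton (Y ⧸ P) := ⟨fun a b => by
      obtain ⟨x, rfl⟩ := mkQ_surjective _ a
      obtain ⟨y, rfl⟩ := mkQ_surjective _ b
      rw [mkQ_apply, mkQ_apply, Submodule.Quotient.eq, hPdef, mem_smul_top_iff]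
      exact hsurj (x - y)⟩
    rw [additive_eq_zero_of_subsingleton' ψ hψ ρQ, additive_eq_zero_of_subsingleton' ψ hψ ρT]
  · -- `T ≠ 0`: go through `P = pY`, of smaller cardinality
    -- the endomorphism `p·`
    let π : Y →ₗ[ℤ] Y := (p : ℤ) • LinearMap.id
    have hπ : ∀ y, π y = (p : ℤ) • y := fun _ => rfl
    have hkerπ : LinearMap.ker π = T := by
      ext x; rw [LinearMap.mem_ker, hTdef, mem_torsionBy_iff]; rfl
    have hranπ : LinearMap.range π = P := by
      ext x; rw [LinearMap.mem_range, hPdef, mem_smul_top_iff]; rfl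
    have hcard : Nat.card T * Nat.card P = Nat.card Y := by
      rw [← hkerπ, ← hranπ]; exact natCard_ker_mul_natCard_range π
    have hlt : Nat.card P < n := by
      have hT1 : 1 < Nat.card T := by
        rw [Finite.one_lt_card_iff_nontrivial]
        exact (Submodule.nontrivial_iff_ne_bot).2 hbot
      have hP0 : 0 < Nat.card P := Nat.card_pos
      rw [← hn, ← hcard]
      nlinarith
    -- induction hypothesis for `P`
    have ihP := ih (Nat.card P) hlt ρP rfl
    -- (S1) `0 → ker φ → Y/pY →(φ) P/pP → 0`, `φ [y] = [p y]`
    let mulP : Y →ₗ[ℤ] P := LinearMap.codRestrict P π fun y => by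
      rw [hPdef, mem_smul_top_iff]; exact ⟨y, rfl⟩
    have hmulP : ∀ s y, mulP (ρY s y) = ρP s (mulP y) := fun s y => by
      apply Subtype.ext
      change (p : ℤ) • ρY s y = ρY s ((p : ℤ) • y)
      rw [map_zsmul]
    have hφ₀ : ((p : ℤ) • ⊤ : Submodule ℤ Y) ≤ ((p : ℤ) • ⊤ : Submodule ℤ P).comap mulP := by
      intro y hy
      obtain ⟨z, rfl⟩ := (mem_smul_top_iff _ _).1 hy
      exact (mem_smul_top_iff _ _).2 ⟨mulP z, by rw [map_zsmul]⟩
    let φ : (Y ⧸ P) →ₗ[ℤ] (P ⧸ ((p : ℤ) • ⊤ : Submodule ℤ P)) := mapQ _ _ mulP hφ₀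
    have hφρ : ∀ s q, φ (ρQ s q) = (ρP.quotient _ (smul_top_le_comap ρP (p : ℤ))) s (φ q) := by
      intro s q
      obtain ⟨y, rfl⟩ := mkQ_surjective _ q
      change Submodule.Quotient.mk (mulP (ρY s y)) = Submodule.Quotient.mk (ρP s (mulP y))
      rw [hmulP]
    have hφsurj : Function.Surjective φ := by
      intro z
      obtain ⟨⟨x, hx⟩, rfl⟩ := mkQ_surjective _ z
      obtain ⟨y, rfl⟩ := (mem_smul_top_iff _ _).1 hx
      exact ⟨Submodule.Quotient.mk y, rfl⟩
    haveI : Finite (P ⧸ ((p : ℤ) • ⊤ : Submodule ℤ P)) := Finite.of_surjective φ hφsurj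
    have h1 := Admissible.additive_eq_ker_add_of_surjective ψ _ hψ' ρQ
      (ρP.quotient _ (smul_top_le_comap ρP (p : ℤ))) ⟨inferInstance, hQtors⟩ φ hφρ hφsurj
    -- (S2) `τ : T → Y/pY`, `ψ(T) = ψ(ker τ) + ψ(range τ)`
    let τ : T →ₗ[ℤ] (Y ⧸ P) := P.mkQ ∘ₗ T.subtype
    have hτρ : ∀ s t, τ (ρT s t) = ρQ s (τ t) := fun _ _ => rfl
    have h2 := Admissible.additive_eq_ker_add_range ψ _ hψ' ρT ρQ ⟨inferInstance, hTtors⟩ τ hτρ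
    -- `range τ = ker φ`
    have hRK : LinearMap.range τ = LinearMap.ker φ := by
      apply le_antisymm
      · rintro _ ⟨t, rfl⟩
        rw [LinearMap.mem_ker]
        change Submodule.Quotient.mk (mulP (t : Y)) = 0
        rw [Submodule.Quotient.mk_eq_zero]
        have : mulP (t : Y) = 0 := Subtype.ext (by
          change (p : ℤ) • (t : Y) = 0; exact (mem_torsionBy_iff _ _).1 t.2)
        rw [this]; exact zero_mem _
      · intro q hq
        obtain ⟨y, rfl⟩ := mkQ_surjective _ q
        rw [LinearMap.mem_ker, mkQ_apply] at hq
        change Submodule.Quotient.mk (mulP y) = 0 at hq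
        rw [Submodule.Quotient.mk_eq_zero, mem_smul_top_iff] at hq
        obtain ⟨⟨z, hz⟩, hzq⟩ := hq
        have hzq' : (p : ℤ) • z = (p : ℤ) • y := by
          have := congrArg Subtype.val hzq
          rwa [Submodule.coe_smul] at this
        have hyz : y - z ∈ T := by
          rw [hTdef, mem_torsionBy_iff, smul_sub, hzq', sub_self]
        refine ⟨⟨y - z, hyz⟩, ?_⟩
        change Submodule.Quotient.mk (y - z) = Submodule.Quotient.mk y
        rw [Submodule.Quotient.eq, sub_sub_cancel_left, neg_mem_iff]
        exact hz
    have h3 : ψ (ρQ.subrepresentation (LinearMap.range τ) (range_le_comap_of_comm ρT ρQ τ hτρ)) =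
        ψ (ρQ.subrepresentation (LinearMap.ker φ) (ker_le_comap_of_comm ρQ _ φ hφρ)) :=
      subrepresentation_congr ψ ρQ hRK _ _
    -- `ker τ ≅ P[p]`
    have hkerτ : ∀ t : T, t ∈ LinearMap.ker τ ↔ (t : Y) ∈ P := fun t => by
      rw [LinearMap.mem_ker]
      change Submodule.Quotient.mk (t : Y) = 0 ↔ _
      exact Submodule.Quotient.mk_eq_zero P
    let e : LinearMap.ker τ →ₗ[ℤ] torsionBy ℤ P (p : ℤ) :=
      { toFun := fun t => ⟨⟨((t : T) : Y), (hkerτ t).1 t.2⟩, (mem_torsionBy_iff _ _).2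
          (Subtype.ext (by rw [Submodule.coe_smul, Submodule.coe_zero]
                           exact (mem_torsionBy_iff _ _).1 (t : T).2))⟩
        map_add' := fun _ _ => rfl
        map_smul' := fun _ _ => rfl }
    have hebij : Function.Bijective e := by
      constructor
      · intro a b hab
        have := congrArg (fun y : torsionBy ℤ P (p : ℤ) => ((y : P) : Y)) hab
        exact Subtype.ext (Subtype.ext this)
      · intro y
        have h0 : (p : ℤ) • (y : P) = 0 := (mem_torsionBy_iff _ _).1 y.2
        have hy : (p : ℤ) • ((y : P) : Y) = 0 := by
          rw [← Submodule.coe_smul, h0, Submodule.coe_zero]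
        refine ⟨⟨⟨((y : P) : Y), (mem_torsionBy_iff _ _).2 hy⟩, (hkerτ _).2 (y : P).2⟩, rfl⟩
    have h4 : ψ (ρT.subrepresentation (LinearMap.ker τ) (ker_le_comap_of_comm ρT ρQ τ hτρ)) =
        ψ (ρP.subrepresentation (torsionBy ℤ P (p : ℤ)) (torsionBy_le_comap ρP (p : ℤ))) :=
      Admissible.additive_eq_of_linearEquiv ψ _ good_quot hψ' _ _
        ⟨inferInstance, fun y => Subtype.ext (by
          rw [Submodule.coe_smul, Submodule.coe_zero]; exact (mem_torsionBy_iff _ _).1 y.2)⟩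
        (LinearEquiv.ofBijective e hebij) (fun _ _ => rfl)
    -- assemble: ψ(Y/p) = ψ(K) + ψ(P/pP) = ψ(K) + ψ(P[p]) = ψ(T)
    have h5 := h2.trans (congrArg₂ (· + ·) h4 h3)
    rw [h1, ihP, h5]
    exact add_comm _ _

end StableLatticeReduction.Int

end Literature.RepresentationTheory.FiniteGroups
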